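import Literature.AlgebraicTopology.Homotopy.GlueSpheres
import Literature.AlgebraicTopology.Homotopy.SlabAdditivity
import HarnessLib

/-!
# The class of a glued sphere with pieces separated by walls is the product of the classes

Topic `Literature/AlgebraicTopology/Homotopy`, combining `GlueSpheres.lean` (the glued sphere
`CSphere.glue ψ K …` of finitely many compactly supported spheres `ψᵢ` with closed supports `Kᵢ`)
and `SlabAdditivity.lean` (`CSphere.toClass_eq_prod_slabPiece`: the class of a sphere cut by
monotone walls `w₀ ≤ ⋯ ≤ wₘ` is the product of the classes of its slab pieces):

* `CSphere.toClass_glue_eq_prod`: if the support of the `i`-th piece lies in the open slab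
  `{wᵢ < y₀ < wᵢ₊₁}` of a monotone sequence of walls, then
  `toClass (glue ψ K …) = ∏ᵢ toClass ψᵢ` (`k ≥ 2`).

Everything is proved; `[folklore]` (Hatcher, *Algebraic Topology* (2002), §4.1, p. 340: the sum
in `πₙ` of maps with disjoint supports lined up along a coordinate).

## References

* A. Hatcher, *Algebraic Topology*, CUP (2002), §4.1, p. 340. [HatcherAT2002]
-/

noncomputable section

open Set Metric unitInterval Topology
open scoped Topology.Homotopy

universe u

namespace Literature.AlgebraicTopology.Homotopy

namespace CSphere

variable {k : ℕ} {X : Type u} [TopologicalSpace X] {x₀ : X}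

/-- With monotone walls, `wᵢ < wⱼ₊₁` and `wⱼ < wᵢ₊₁` force `i = j`. [folklore] -/
theorem eq_of_walls {m : ℕ} {w : Fin (m + 1) → ℝ} (hw : Monotone w) {i j : Fin m}
    (h₁ : w i.castSucc < w j.succ) (h₂ : w j.castSucc < w i.succ) : i = j := by
  have h1 : (i : ℕ) < j + 1 := by
    by_contra hcon
    have : j.succ ≤ i.castSucc := Fin.le_def.2 (by simp; omega)
    exact absurd (hw this) (not_le.2 h₁)
  have h2 : (j : ℕ) < i + 1 := by
    by_contra hcon
    have : i.succ ≤ j.castSucc := Fin.le_def.2 (by simp; omega)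
    exact absurd (hw this) (not_le.2 h₂)
  exact Fin.ext (by omega)

/-- **The class of a glued sphere is the product of the classes of its pieces**, when the
support of the `i`-th piece lies in the open slab `{wᵢ < y₀ < wᵢ₊₁}` of a monotone sequence of
walls (`k ≥ 2`). [folklore] -/
theorem toClass_glue_eq_prod [NeZero k] [Nontrivial (Fin k)] {m : ℕ} (ψ : Fin m → CSphere k X x₀)
    (K : Fin m → Set (Fin k → ℝ)) (hK : ∀ i, IsClosed (K i))
    (hagree : ∀ i j y, y ∈ K i → y ∈ K j → ψ i y = ψ j y)
    (hoff : ∀ i y, y ∉ interior (K i) → ψ i y = x₀)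
    (w : Fin (m + 1) → ℝ) (hw : Monotone w)
    (hKw : ∀ i, ∀ y ∈ K i, w i.castSucc < y 0 ∧ y 0 < w i.succ) :
    (glue ψ K hK hagree hoff).toClass = ∏ i, (ψ i).toClass := by
  set G := glue ψ K hK hagree hoff with hG
  -- off its support a piece is `x₀`
  have hoffK : ∀ i y, y ∉ K i → ψ i y = x₀ := fun i y hy => hoff i y fun h => hy (interior_subset h)
  -- `G` vanishes wherever no support passes: on the walls, below `w₀`, above `wₘ`
  have hGnot : ∀ y : Fin k → ℝ, (∀ i, y ∉ K i) → G y = x₀ := fun y hy => glue_apply_of_forall_not_mem hy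
  have hwall : ∀ j, ∀ y : Fin k → ℝ, y 0 = w j → G y = x₀ := by
    intro j y hy
    refine hGnot y fun i hi => ?_
    obtain ⟨h1, h2⟩ := hKw i y hi
    rw [hy] at h1 h2
    have h3 : (i : ℕ) < j := by
      by_contra hcon
      exact absurd (hw (Fin.le_def.2 (by simp; omega) : j ≤ i.castSucc)) (not_le.2 h1)
    have h4 : (j : ℕ) < i + 1 := by
      by_contra hcon
      exact absurd (hw (Fin.le_def.2 (by simp; omega) : i.succ ≤ j)) (not_le.2 h2)
    omega
  have hlo : ∀ y : Fin k → ℝ, y 0 ≤ w 0 → G y = x₀ := by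
    intro y hy
    refine hGnot y fun i hi => ?_
    have h1 := (hKw i y hi).1
    have : w 0 ≤ w i.castSucc := hw (Fin.zero_le _)
    linarith
  have hhi : ∀ y : Fin k → ℝ, w (Fin.last m) ≤ y 0 → G y = x₀ := by
    intro y hy
    refine hGnot y fun i hi => ?_
    have h2 := (hKw i y hi).2
    have : w i.succ ≤ w (Fin.last m) := hw (Fin.le_last _)
    linarith
  rw [toClass_eq_prod_slabPiece m G w hw hwall hlo hhi]
  refine Finset.prod_congr rfl fun i _ => ?_
  -- the `i`-th slab piece of `G` is `ψᵢ`
  congr 1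
  refine ext fun y => ?_
  rw [slabPiece_apply]
  by_cases hyK : y ∈ K i
  · rw [if_pos ⟨(hKw i y hyK).1.le, (hKw i y hyK).2.le⟩]
    exact glue_apply_of_mem hyK
  · rw [hoffK i y hyK]
    split_ifs with hslab
    · refine hGnot y fun j hj => ?_
      obtain ⟨h1, h2⟩ := hKw j y hj
      have hij : i = j := eq_of_walls hw (hslab.1.trans_lt h2) (h1.trans_le hslab.2)
      subst hij
      exact hyK hj
    · rfl

end CSphere

end Literature.AlgebraicTopology.Homotopy

end
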